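import Summits.CriticalPhenomena.PercolationContinuityZ3.Theorems.Transplant.GrigorchukFiniteModel
import Summits.CriticalPhenomena.PercolationContinuityZ3.Theorems.Transplant.GrigorchukLamplighterCriticalContinuity
import Summits.CriticalPhenomena.PercolationContinuityZ3.Theorems.Transplant.GrigorchukLamplighterStandardGensNoGo
import Summits.CriticalPhenomena.PercolationContinuityZ3.Theorems.Transplant.GrigorchukLamplighterCharacters
import HarnessLib

/-!
# Short relations and certified NON-relations among the letters `a, b, c, d, s^{±1}` of `Γ₂ = ℤ ≀_X 𝔊` — the word facts behind the label-rigidity census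
# of `Cay(ℤ ≀_X 𝔊; a, b, c, d, s)`

builds on p205010 (kernel theorem, internal audit signed; external expert review pending) — nothing in this file uses p205010; pure group theory about
`Γ₂ = wreathZ` («GrigorchukLamplighterDefs» p581401), no percolation statement, nothing about any `@[conjecture]`.  Lane `prim-bschramm`, seat
`prim-bschramm-p3` gen 36 (DESIGN OWNER; `P3-NILPOTENT.md` §29.1).  Helper file (`--supports stmt-CriticalPhenomena-4575 --as helper`).

CONTENT.  `W ℓ` (a tree letter of `Γ₂` named by p590723's `Letter`), `stdGens = {a,b,c,d,s}`, the codes `L6` of the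
six letters with `toW`, `prodW`;
* §1 RELATIONS: involutions, the Klein table `b c = d, …`, `[s, b] = [s, c] = [s, d] = 1` (ρ is fixed by `b, c, d`), `(a d)⁴ = 1`, `(a c)⁸ = 1` (direct
  ray computations with p590401's `cons` recursion — identities are NEVER taken from a finite level);
* §2 SEPARATION: the Boolean test `sepB` (lamp-sum totals differ, or the finite models of the tree words differ on `000` or `100` — the finite model
  «GrigorchukFiniteModel», SOUND direction only) and its soundness `prodW_ne_of_sep`; every non-relation below is ONE `decide` per letter case;
* §3 THE CERTIFIED NON-RELATIONS the census needs: no product of two letters is `a` or `s` (no triangle through an `a`- or `s`-edge), `a t y ≠ t′` for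
  tree letters `t, t′` and any letter `y` (no `T`-cornered square through an `a`-edge), the letters are `≠ 1` and pairwise distinct, and the alternating
  tables of «GrigorchukFiniteModel» lifted to `Γ₂` (`alt8W_ne_one`, `alt16W_ne_one`).
[cite: Grigorchuk1980, definition of a, b, c, d; relations a² = b² = c² = d² = bcd = (ad)⁴ = 1] [cite: BartholdiErschler2012, §2–§3.1]
-/

noncomputable section

namespace Summit.CriticalPhenomena.PercolationContinuityZ3.Theorems.Transplant

namespace Grigorchuk

open SemidirectProduct
open scoped Classical

/-! ### §0 The letters -/

/-- The tree letter of `Γ₂` named by `ℓ`. [cite: BartholdiErschler2012, §2 (the embedding g ↦ (1, g))] -/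
def W (ℓ : Letter) : ↥wreathZ := ⟨tree ℓ.toPerm, tree_mem_wreathZ (Letter.toPerm_mem ℓ)⟩

/-- Bartholdi–Erschler's STANDARD generating set `{a, b, c, d, s}` of `Γ₂`. [cite: BartholdiErschler2012, §2 (standard generating set)] -/
def stdGens : Finset ↥wreathZ := {aW, bW, cW, dW, sW}

/-- Tree parts of the letters. [folklore] -/
@[simp] theorem right_W (ℓ : Letter) : ((W ℓ : ↥wreathZ) : LampGroup ℤ).right = ℓ.toPerm := rfl
/-- Tree parts of the letters. [folklore] -/
@[simp] theorem right_aW : ((aW : ↥wreathZ) : LampGroup ℤ).right = genA := rfl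
/-- Tree parts of the letters. [folklore] -/
@[simp] theorem right_bW : ((bW : ↥wreathZ) : LampGroup ℤ).right = genB := rfl
/-- Tree parts of the letters. [folklore] -/
@[simp] theorem right_cW : ((cW : ↥wreathZ) : LampGroup ℤ).right = genC := rfl
/-- Tree parts of the letters. [folklore] -/
@[simp] theorem right_dW : ((dW : ↥wreathZ) : LampGroup ℤ).right = genD := rfl
/-- Tree parts of the letters. [folklore] -/
@[simp] theorem right_sW : ((sW : ↥wreathZ) : LampGroup ℤ).right = 1 := rfl

/-! ### §1 Relations -/

/-- The generators lie in `𝔊`. [folklore] -/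
theorem gen_mem : genA ∈ grigorchukGroup ∧ genB ∈ grigorchukGroup ∧ genC ∈ grigorchukGroup ∧ genD ∈ grigorchukGroup :=
  ⟨Letter.toPerm_mem .a, Letter.toPerm_mem (.x .b), Letter.toPerm_mem (.x .c), Letter.toPerm_mem (.x .d)⟩

/-- `b, c, d` are involutions. [cite: Grigorchuk1980, b² = c² = d² = 1] -/
theorem sectionGen_mul_self (P : ℕ → Bool) :
    ((sectionGen_involutive P).toPerm _ : Equiv.Perm Ray) * (sectionGen_involutive P).toPerm _ = 1 :=
  Equiv.ext fun x => sectionGen_involutive P x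

/-- `b² = 1`. [cite: Grigorchuk1980, b² = 1] -/
theorem genB_mul_genB : genB * genB = 1 := sectionGen_mul_self _
/-- `c² = 1`. [cite: Grigorchuk1980, c² = 1] -/ theorem genC_mul_genC : genC * genC = 1 := sectionGen_mul_self _
/-- `d² = 1`. [cite: Grigorchuk1980, d² = 1] -/ theorem genD_mul_genD : genD * genD = 1 := sectionGen_mul_self _

/-- The tree letters are their own inverses (from p592894's `tree_letters_sq`). [cite: Grigorchuk1980, a² = b² = c² = d² = 1] -/
theorem letters_inv : aW⁻¹ = aW ∧ bW⁻¹ = bW ∧ cW⁻¹ = cW ∧ dW⁻¹ = dW :=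
  ⟨inv_eq_of_mul_eq_one_right tree_letters_sq.1, inv_eq_of_mul_eq_one_right tree_letters_sq.2.1,
    inv_eq_of_mul_eq_one_right tree_letters_sq.2.2.1, inv_eq_of_mul_eq_one_right tree_letters_sq.2.2.2⟩

/-- A product of two tree letters of `Γ₂` is the tree letter of the product. [folklore] -/
theorem tree_mul_tree_eq {g h k : Equiv.Perm Ray} (hg : g ∈ grigorchukGroup) (hh : h ∈ grigorchukGroup) (hk : k ∈ grigorchukGroup)
    (e : g * h = k) : (⟨tree g, tree_mem_wreathZ hg⟩ * ⟨tree h, tree_mem_wreathZ hh⟩ : ↥wreathZ) = ⟨tree k, tree_mem_wreathZ hk⟩ :=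
  Subtype.ext (show (inr g * inr h : LampGroup ℤ) = inr k by rw [← map_mul, e])

/-- **The Klein table in `Γ₂`**: `b c = d`, `c b = d`, `b d = c`, `d b = c`, `c d = b`, `d c = b`. [cite: Grigorchuk1980, bcd = 1, {1,b,c,d} ≅ (ℤ/2)²] -/
theorem klein : bW * cW = dW ∧ cW * bW = dW ∧ bW * dW = cW ∧ dW * bW = cW ∧ cW * dW = bW ∧ dW * cW = bW := by
  obtain ⟨-, hb, hc, hd⟩ := gen_mem
  exact ⟨tree_mul_tree_eq hb hc hd (V4.toPerm_mul .b .c).symm, tree_mul_tree_eq hc hb hd (V4.toPerm_mul .c .b).symm,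
    tree_mul_tree_eq hb hd hc (V4.toPerm_mul .b .d).symm, tree_mul_tree_eq hd hb hc (V4.toPerm_mul .d .b).symm,
    tree_mul_tree_eq hc hd hb (V4.toPerm_mul .c .d).symm, tree_mul_tree_eq hd hc hb (V4.toPerm_mul .d .c).symm⟩

/-- **The lamp letter commutes with `b, c, d`** (they fix `ρ`). [cite: BartholdiErschler2012, §3.1 (ρ = 1^∞ is fixed by b, c, d)] -/
theorem sW_comm : sW * bW = bW * sW ∧ sW * cW = cW * sW ∧ sW * dW = dW * sW := by
  have key : ∀ {g : Equiv.Perm Ray}, g rho = rho → (lamp rho 1 : LampGroup ℤ) * tree g = tree g * lamp rho 1 := by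
    intro g hg
    have h := tree_mul_lamp_mul_tree_inv (M := ℤ) g rho 1
    rw [hg] at h
    calc (lamp rho 1 : LampGroup ℤ) * tree g = tree g * lamp rho 1 * (tree g)⁻¹ * tree g := by rw [h]
      _ = tree g * lamp rho 1 := by rw [inv_mul_cancel_right]
  exact ⟨Subtype.ext (key genB_rho), Subtype.ext (key genC_rho), Subtype.ext (key genD_rho)⟩

/-- `(a d)²` acts as `(b, b)`: `(a d a d)(i·y) = i·(b y)`. [cite: Grigorchuk1980, (ad)⁴ = 1] -/
theorem ad_sq_cons (i : Bool) (y : Ray) : (genA * genD * (genA * genD)) (cons i y) = cons i (genB y) := by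
  simp only [Equiv.Perm.mul_apply]
  cases i
  · rw [genD_cons_false, genA_cons, Bool.not_false, genD_cons_true, genA_cons, Bool.not_true]
  · rw [genD_cons_true, genA_cons, Bool.not_true, genD_cons_false, genA_cons, Bool.not_false]

/-- **`(a d)⁴ = 1`.** [cite: Grigorchuk1980, (ad)⁴ = 1] -/
theorem ad_pow_four : (genA * genD) ^ 4 = 1 := by
  rw [show (4 : ℕ) = 2 * 2 by norm_num, pow_mul, sq, sq]
  refine Equiv.ext fun x => ?_
  rw [Equiv.Perm.mul_apply, ← cons_head_tail x, ad_sq_cons, ad_sq_cons, ← Equiv.Perm.mul_apply, genB_mul_genB,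
    Equiv.Perm.one_apply, Equiv.Perm.one_apply]

/-- `(d a)²` acts as `(b, b)` as well. [cite: Grigorchuk1980, (ad)⁴ = 1] -/
theorem da_sq_cons (i : Bool) (y : Ray) : (genD * genA * (genD * genA)) (cons i y) = cons i (genB y) := by
  simp only [Equiv.Perm.mul_apply]
  cases i
  · rw [genA_cons, Bool.not_false, genD_cons_true, genA_cons, Bool.not_true, genD_cons_false]
  · rw [genA_cons, Bool.not_true, genD_cons_false, genA_cons, Bool.not_false, genD_cons_true]

/-- `(d a)⁴ = 1`. [cite: Grigorchuk1980, (ad)⁴ = 1] -/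
theorem da_pow_four : (genD * genA) ^ 4 = 1 := by
  rw [show (4 : ℕ) = 2 * 2 by norm_num, pow_mul, sq, sq]
  refine Equiv.ext fun x => ?_
  rw [Equiv.Perm.mul_apply, ← cons_head_tail x, da_sq_cons, da_sq_cons, ← Equiv.Perm.mul_apply, genB_mul_genB,
    Equiv.Perm.one_apply, Equiv.Perm.one_apply]

/-- `(a c)²` acts as `(d a, a d)`: `(a c a c)(1·y) = 1·(a d y)`, `(a c a c)(0·y) = 0·(d a y)`. [cite: Grigorchuk1980, c = (a, d)] -/
theorem ac_sq_cons (y : Ray) : (genA * genC * (genA * genC)) (cons true y) = cons true ((genA * genD) y) ∧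
    (genA * genC * (genA * genC)) (cons false y) = cons false ((genD * genA) y) := by
  simp only [Equiv.Perm.mul_apply]
  constructor
  · rw [genC_cons_true, genA_cons, Bool.not_true, genC_cons_false, genA_cons, Bool.not_false]
  · rw [genC_cons_false, genA_cons, Bool.not_false, genC_cons_true, genA_cons, Bool.not_true]

/-- Powers of `(a c)²` on the two subtrees. [folklore] -/
theorem ac_sq_pow_cons (n : ℕ) (y : Ray) : ((genA * genC * (genA * genC)) ^ n) (cons true y) = cons true (((genA * genD) ^ n) y) ∧
    ((genA * genC * (genA * genC)) ^ n) (cons false y) = cons false (((genD * genA) ^ n) y) := by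
  induction n generalizing y with
  | zero => simp
  | succ n ih =>
    constructor
    · rw [pow_succ, Equiv.Perm.mul_apply, (ac_sq_cons y).1, (ih _).1, ← Equiv.Perm.mul_apply, ← pow_succ]
    · rw [pow_succ, Equiv.Perm.mul_apply, (ac_sq_cons y).2, (ih _).2, ← Equiv.Perm.mul_apply, ← pow_succ]

/-- **`(a c)⁸ = 1`.** [cite: Grigorchuk1980, c = (a, d), (ad)⁴ = 1 (hence (ac)⁸ = 1)] -/
theorem ac_pow_eight : (genA * genC) ^ 8 = 1 := by
  rw [show (8 : ℕ) = 2 * 4 by norm_num, pow_mul, sq]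
  refine Equiv.ext fun x => ?_
  rw [← cons_head_tail x, Equiv.Perm.one_apply]
  cases x 0
  · rw [(ac_sq_pow_cons 4 _).2, da_pow_four, Equiv.Perm.one_apply]
  · rw [(ac_sq_pow_cons 4 _).1, ad_pow_four, Equiv.Perm.one_apply]

/-- The tree letter of a product of letters: `W`-words multiply inside `tree`. [folklore] -/
theorem coe_right_pow (π : ↥wreathZ) (n : ℕ) : ((π ^ n : ↥wreathZ) : LampGroup ℤ).right = ((π : LampGroup ℤ)).right ^ n := by
  rw [Subgroup.coe_pow, ← rightHom_eq_right, map_pow, rightHom_eq_right]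

/-- An element of `Γ₂` with trivial lamp part and trivial tree part is trivial. [folklore] -/
theorem eq_one_of_parts {π : ↥wreathZ} (hl : ((π : LampGroup ℤ)).left = 1) (hr : ((π : LampGroup ℤ)).right = 1) : π = 1 :=
  Subtype.ext (SemidirectProduct.ext (by rw [hl, Subgroup.coe_one, one_left]) (by rw [hr, Subgroup.coe_one, one_right]))

/-- A product of tree letters has trivial lamp part. [folklore] -/
theorem left_eq_one_of_right {π₁ π₂ : ↥wreathZ} (h₁ : ((π₁ : LampGroup ℤ)).left = 1) (h₂ : ((π₂ : LampGroup ℤ)).left = 1) :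
    (((π₁ * π₂ : ↥wreathZ)) : LampGroup ℤ).left = 1 := by
  rw [Subgroup.coe_mul, mul_left, h₁, h₂, map_one, one_mul]

/-- **`(a d)⁴ = 1` in `Γ₂`.** [cite: Grigorchuk1980, (ad)⁴ = 1] -/
theorem aW_dW_pow_four : (aW * dW) ^ 4 = 1 := by
  refine eq_one_of_parts ?_ ?_
  · have h : (((aW * dW : ↥wreathZ)) : LampGroup ℤ).left = 1 := left_eq_one_of_right rfl rfl
    rw [Subgroup.coe_pow]
    -- powers of a lamp-free element are lamp-free
    have : ∀ n : ℕ, ((((aW * dW : ↥wreathZ)) : LampGroup ℤ) ^ n).left = 1 := by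
      intro n
      induction n with
      | zero => rw [pow_zero, one_left]
      | succ n ih => rw [pow_succ, mul_left, ih, h, map_one, one_mul]
    exact this 4
  · rw [coe_right_pow, Subgroup.coe_mul, mul_right, right_aW, right_dW, ad_pow_four]

/-- **`(a c)⁸ = 1` in `Γ₂`.** [cite: Grigorchuk1980, (ac)⁸ = 1] -/
theorem aW_cW_pow_eight : (aW * cW) ^ 8 = 1 := by
  refine eq_one_of_parts ?_ ?_
  · have h : (((aW * cW : ↥wreathZ)) : LampGroup ℤ).left = 1 := left_eq_one_of_right rfl rfl
    rw [Subgroup.coe_pow]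
    have : ∀ n : ℕ, ((((aW * cW : ↥wreathZ)) : LampGroup ℤ) ^ n).left = 1 := by
      intro n
      induction n with
      | zero => rw [pow_zero, one_left]
      | succ n ih => rw [pow_succ, mul_left, ih, h, map_one, one_mul]
    exact this 8
  · rw [coe_right_pow, Subgroup.coe_mul, mul_right, right_aW, right_cW, ac_pow_eight]

/-! ### §2 The six letters as codes; separation by lamp sum and by the finite model -/

/-- Codes for the six letters `a, b, c, d, s, s⁻¹`. [cite: BartholdiErschler2012, §2 (standard generating set)] -/
inductive L6 | a | b | c | d | s | si
  deriving DecidableEq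

/-- The letter of `Γ₂` named by a code. [folklore] -/
def L6.toW : L6 → ↥wreathZ
  | .a => aW
  | .b => bW
  | .c => cW
  | .d => dW
  | .s => sW
  | .si => sW⁻¹

/-- The tree word of a code (`s^{±1}` have trivial tree part). [folklore] -/
def L6.treeWord : L6 → List Letter
  | .a => [.a]
  | .b => [.x .b]
  | .c => [.x .c]
  | .d => [.x .d]
  | .s => []
  | .si => []

/-- The lamp sum of a code. [folklore] -/
def L6.lsum : L6 → ℤ
  | .s => 1
  | .si => -1
  | _ => 0

/-- A code names a tree letter `b, c, d`. [folklore] -/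
def L6.isTree : L6 → Bool
  | .b => true
  | .c => true
  | .d => true
  | _ => false

/-- The product of the letters named by a list of codes. [folklore] -/
def prodW : List L6 → ↥wreathZ
  | [] => 1
  | y :: ys => y.toW * prodW ys

/-- The tree word of a list of codes. [folklore] -/
def treeWords : List L6 → List Letter
  | [] => []
  | y :: ys => y.treeWord ++ treeWords ys

/-- The lamp-sum total of a list of codes. [folklore] -/
def lsums : List L6 → ℤ
  | [] => 0
  | y :: ys => y.lsum + lsums ys

/-- **`x ∈ S ∪ S⁻¹` iff `x` is one of the six letters named by codes.** [folklore] -/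
theorem mem_stdGens_or_inv_iff {x : ↥wreathZ} : (x ∈ stdGens ∨ x⁻¹ ∈ stdGens) ↔ ∃ y : L6, x = y.toW := by
  have key : (x = aW ∨ x = bW ∨ x = cW ∨ x = dW ∨ x = sW ∨ x = sW⁻¹) ↔ ∃ y : L6, x = y.toW := by
    constructor
    · rintro (rfl | rfl | rfl | rfl | rfl | rfl)
      exacts [⟨.a, rfl⟩, ⟨.b, rfl⟩, ⟨.c, rfl⟩, ⟨.d, rfl⟩, ⟨.s, rfl⟩, ⟨.si, rfl⟩]
    · rintro ⟨y, rfl⟩; cases y <;> simp [L6.toW]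
  rw [← key]
  simp only [stdGens, Finset.mem_insert, Finset.mem_singleton, inv_eq_iff_eq_inv, letters_inv.1, letters_inv.2.1,
    letters_inv.2.2.1, letters_inv.2.2.2]
  tauto

/-- Tree part of the letter named by a code. [folklore] -/
theorem right_toW (y : L6) : ((y.toW : ↥wreathZ) : LampGroup ℤ).right = evalPerm y.treeWord := by
  cases y
  · simp only [L6.toW, L6.treeWord, right_aW, evalPerm_cons, evalPerm_nil, Letter.toPerm, mul_one]
  · simp only [L6.toW, L6.treeWord, right_bW, evalPerm_cons, evalPerm_nil, Letter.toPerm, BCD.toPerm, BCD.toV4, V4.toPerm, mul_one]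
  · simp only [L6.toW, L6.treeWord, right_cW, evalPerm_cons, evalPerm_nil, Letter.toPerm, BCD.toPerm, BCD.toV4, V4.toPerm, mul_one]
  · simp only [L6.toW, L6.treeWord, right_dW, evalPerm_cons, evalPerm_nil, Letter.toPerm, BCD.toPerm, BCD.toV4, V4.toPerm, mul_one]
  · simp only [L6.toW, L6.treeWord, right_sW, evalPerm_nil]
  · simp only [L6.toW, L6.treeWord, Subgroup.coe_inv, inv_right, right_sW, inv_one, evalPerm_nil]

/-- Lamp sum of the letter named by a code. [folklore] -/
theorem lampSum_toW (y : L6) : lampSum ℤ ((y.toW : ↥wreathZ) : LampGroup ℤ) = Multiplicative.ofAdd y.lsum := by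
  cases y
  · simp only [L6.toW, L6.lsum, lampSum_tree_letters.1, ofAdd_zero]
  · simp only [L6.toW, L6.lsum, lampSum_tree_letters.2.1, ofAdd_zero]
  · simp only [L6.toW, L6.lsum, lampSum_tree_letters.2.2.1, ofAdd_zero]
  · simp only [L6.toW, L6.lsum, lampSum_tree_letters.2.2.2, ofAdd_zero]
  · simp only [L6.toW, L6.lsum, lampSum_sW]
  · simp only [L6.toW, L6.lsum, Subgroup.coe_inv, map_inv, lampSum_sW, ofAdd_neg]

/-- `evalPerm` is multiplicative on concatenations. [folklore] -/
theorem evalPerm_append (w w' : List Letter) : evalPerm (w ++ w') = evalPerm w * evalPerm w' := by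
  induction w with
  | nil => rw [List.nil_append, evalPerm_nil, one_mul]
  | cons x w ih => rw [List.cons_append, evalPerm_cons, evalPerm_cons, ih, mul_assoc]

/-- Tree part of a product of letters: the product of the tree words. [folklore] -/
theorem right_prodW (ys : List L6) : ((prodW ys : ↥wreathZ) : LampGroup ℤ).right = evalPerm (treeWords ys) := by
  induction ys with
  | nil => rfl
  | cons y ys ih => rw [prodW, treeWords, Subgroup.coe_mul, mul_right, right_toW, ih, evalPerm_append]

/-- Lamp sum of a product of letters. [folklore] -/
theorem lampSum_prodW (ys : List L6) : lampSum ℤ ((prodW ys : ↥wreathZ) : LampGroup ℤ) = Multiplicative.ofAdd (lsums ys) := by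
  induction ys with
  | nil => rfl
  | cons y ys ih => rw [prodW, lsums, Subgroup.coe_mul, map_mul, lampSum_toW, ih, ofAdd_add]

/-- **The Boolean separation test**: different lamp-sum totals, or tree words whose finite models differ on `000` or on `100`. [folklore] -/
def sepB (ys ys' : List L6) : Bool :=
  (decide (lsums ys ≠ lsums ys')) ||
    ((evalModel (treeWords ys) [false, false, false] != evalModel (treeWords ys') [false, false, false]) ||
      (evalModel (treeWords ys) [true, false, false] != evalModel (treeWords ys') [true, false, false]))

/-- **Soundness of the separation test**: `sepB ys ys′ ⟹ prodW ys ≠ prodW ys′`. [folklore] -/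
theorem prodW_ne_of_sep {ys ys' : List L6} (h : sepB ys ys' = true) : prodW ys ≠ prodW ys' := by
  intro e
  simp only [sepB, Bool.or_eq_true, decide_eq_true_eq, bne_iff_ne, ne_eq] at h
  rcases h with h | h | h
  · apply h
    have := congrArg (fun π : ↥wreathZ => Multiplicative.toAdd (lampSum ℤ (π : LampGroup ℤ))) e
    simpa only [lampSum_prodW, toAdd_ofAdd] using this
  · exact ne_of_evalModel_ne h (by rw [← right_prodW, ← right_prodW, e])
  · exact ne_of_evalModel_ne h (by rw [← right_prodW, ← right_prodW, e])

/-! ### §3 The certified non-relations -/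

/-- **No product of two letters is `a`** (no triangle through an `a`-edge). [folklore] -/
theorem letter_mul_ne_aW (y z : L6) : y.toW * z.toW ≠ aW := by
  have h : prodW [y, z] ≠ prodW [.a] := prodW_ne_of_sep (by cases y <;> cases z <;> decide)
  simpa only [prodW, mul_one, L6.toW] using h

/-- **No product of two letters is `s`** (no triangle through an `s`-edge). [folklore] -/
theorem letter_mul_ne_sW (y z : L6) : y.toW * z.toW ≠ sW := by
  have h : prodW [y, z] ≠ prodW [.s] := prodW_ne_of_sep (by cases y <;> cases z <;> decide)
  simpa only [prodW, mul_one, L6.toW] using h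

/-- **`a t y ≠ t′` for tree letters `t, t′` and any letter `y`** (no square through an `a`-edge with two tree-letter corners). [folklore] -/
theorem aW_tree_letter_ne (t y t' : L6) (ht : t.isTree = true) (ht' : t'.isTree = true) : aW * t.toW * y.toW ≠ t'.toW := by
  have h : prodW [.a, t, y] ≠ prodW [t'] := prodW_ne_of_sep (by
    revert ht ht'
    cases t <;> cases t' <;> intro ht ht' <;> first | exact absurd ht (by decide) | exact absurd ht' (by decide) | (cases y <;> decide))
  simpa only [prodW, mul_one, L6.toW, mul_assoc] using h

/-- **The six letters are `≠ 1`.** [folklore] -/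
theorem toW_ne_one (y : L6) : y.toW ≠ 1 := by
  have h : prodW [y] ≠ prodW [] := prodW_ne_of_sep (by cases y <;> decide)
  simpa only [prodW, mul_one] using h

/-- **Distinct codes name distinct letters.** [folklore] -/
theorem toW_injective : Function.Injective L6.toW := by
  intro y z e
  by_contra hne
  have h : prodW [y] ≠ prodW [z] := prodW_ne_of_sep (by
    revert hne; cases y <;> cases z <;> intro hne <;> first | exact absurd rfl hne | decide)
  exact h (by simpa only [prodW, mul_one] using e)

/-- A tree code names one of `W b, W c, W d`: the p590723 letter with the same name. [folklore] -/
theorem exists_letter_of_isTree {y : L6} (h : y.isTree = true) : ∃ ℓ : Letter, ℓ.isTree = true ∧ y.toW = W ℓ := by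
  cases y
  · exact absurd h (by decide)
  · exact ⟨.x .b, rfl, rfl⟩
  · exact ⟨.x .c, rfl, rfl⟩
  · exact ⟨.x .d, rfl, rfl⟩
  · exact absurd h (by decide)
  · exact absurd h (by decide)

/-- **The 54 alternating words in `Γ₂`**: `x₁ a x₂ a x₃ a x₄ a ≠ 1` for tree letters with `x₁ ∈ {b, c}`. [folklore] -/
theorem alt8W_ne_one (x₁ x₂ x₃ x₄ : Letter) (h₁ : x₁.isBC = true) (h₂ : x₂.isTree = true) (h₃ : x₃.isTree = true) (h₄ : x₄.isTree = true) :
    W x₁ * aW * W x₂ * aW * W x₃ * aW * W x₄ * aW ≠ 1 := by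
  intro e
  apply alt8_ne_one x₁ x₂ x₃ x₄ h₁ h₂ h₃ h₄
  have h := congrArg (fun π : ↥wreathZ => (π : LampGroup ℤ).right) e
  simp only [Subgroup.coe_mul, Subgroup.coe_one, mul_right, one_right, right_W, right_aW] at h
  simpa only [evalPerm_cons, evalPerm_nil, Letter.toPerm, mul_one, mul_assoc] using h

/-- **The 128 alternating words in `Γ₂`**: `b a x₂ a ⋯ x₈ a ≠ 1` for `xᵢ ∈ {b, c}`. [folklore] -/
theorem alt16W_ne_one (x₂ x₃ x₄ x₅ x₆ x₇ x₈ : Letter) (h₂ : x₂.isBC = true) (h₃ : x₃.isBC = true) (h₄ : x₄.isBC = true)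
    (h₅ : x₅.isBC = true) (h₆ : x₆.isBC = true) (h₇ : x₇.isBC = true) (h₈ : x₈.isBC = true) :
    bW * aW * W x₂ * aW * W x₃ * aW * W x₄ * aW * W x₅ * aW * W x₆ * aW * W x₇ * aW * W x₈ * aW ≠ 1 := by
  intro e
  apply alt16_ne_one x₂ x₃ x₄ x₅ x₆ x₇ x₈ h₂ h₃ h₄ h₅ h₆ h₇ h₈
  have h := congrArg (fun π : ↥wreathZ => (π : LampGroup ℤ).right) e
  simp only [Subgroup.coe_mul, Subgroup.coe_one, mul_right, one_right, right_W, right_aW, right_bW] at h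
  simpa only [evalPerm_cons, evalPerm_nil, Letter.toPerm, BCD.toPerm, BCD.toV4, V4.toPerm, mul_one, mul_assoc] using h

end Grigorchuk

end Summit.CriticalPhenomena.PercolationContinuityZ3.Theorems.Transplant
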